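import Literature.Probability.Percolation.ArcLandedFourArm
import Literature.Probability.Percolation.ArmSeparationFourArm
import HarnessLib

/-!
# Well-separated four arms in the ADJACENT arrangement, and their gluing into the arc-landed host

Topic `Literature/Probability/Percolation`; family `crit-perc`. Definitions with bodies and proofs
(no named fact). Serves the named fact `Literature.Probability.Percolation.Werner2009_lemma63`
(Werner 2009, Lecture 6, Lemma 6.3 for the tree's ORDER-FREE `π̂_t`) through Nolin's Thm. 27 for
the adjacent arrangement, and at the same time the landing hypothesis `hLand` of the tree's
`fourArm_bridge_of_landing_of_flip` / `fourArm_bridge_of_landing` (`ArmPatternsFourArm.lean`,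
`FlipFourArm.lean`: the bridge between the order-free and the alternating four-arm probabilities at
`p = 1/2`, the last discrete input of `fourArm_exponent` on the alternating route). Both need
P. Nolin's separation theorem (EJP 13 (2008), Thm. 11 [arXiv 0711.4948: Thm. 10]) for `j = 4` and
the colour sequence `σ = BBWW`; this file DEFINES its target event and proves the deterministic
half of its use (Prop. 12 [arXiv Prop. 11]: extension and gluing; Kesten 1987, fences), as
`ArmSeparationFourArm.lean` does for `σ = BWBW`:

* `sepArmDuo i b n N` — two disjoint fenced arms of colour `b` landing on the CONSECUTIVE sides
  `i, i + 1` (the tree's `sepArmPair` has opposite sides `i, i + 3`); `sepFourAdj n N =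
  sepArmDuo 0 true n N ∩ sepArmDuo 3 false n N` — **Nolin's `Ã̃^{I/I'}_{4,BBWW}(n, N)`**: fenced
  open arms on sides `0, 1`, fenced closed arms on sides `3, 4`; monotonicity and locality;
* `sepOpenArmIn_glue_core_fence`, `sepOpenArmIn_glueExt_path_fence`,
  `sepOpenArmIn_glue_path_fence` — the gluing lemmas of `ArmSeparationFourArm.lean` with the
  starting site of the glued path EXPORTED as a site of the inner free space of the arm (their
  proofs verbatim; the tree's statements only record `|u|_𝕋 ≤ n₁`, which forgets where the arm
  enters the annulus);
* `triNorm_lt_of_mem_sepInnerFence`, `mem_hexSide_zero_of_adj_cone_inner`,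
  `PathIn.exists_dlandedArm` — **trimming to an arm landed at BOTH ends**: a path that starts
  strictly inside `Λ_r` in the cone over side `0` and leaves `Λ_R` through that cone contains an
  arm of `{r ≤ |·|_𝕋 ≤ R}` from side `0` of `∂Λ_r` (the site after the last visit of `Λ°_r` is
  adjacent to a cone site of norm `r - 1`) to side `0` of `∂Λ_R`;
* `sepArmAt_dlandedArm`, `sepArmAt_glue_path_dlanded`, `sepArmAt_glueExt_path_dlanded` — a fenced
  arm, a glued arm and an extended arm of colour `b` in frame `i` run from side `i` to side `i`;
* `sepFourAdj_subset_arcFourArm` (`4 ≤ n ≤ N`), `sepFourAdj_subset_landedFourAdj`,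
  `adjFourArm_landing_of_adjSeparation` — the fenced event lies in the arc-landed host
  `arcFourArm 0 3 n N` and in the tree's `landedFourAdj n N`; hence **Nolin's Thm. 11 for `BBWW`
  in the form `c · P_t(adjFourArmCyc n N) ≤ P_t(sepFourAdj n N)` implies the landing hypothesis
  `c · P_t(adjFourArm n N) ≤ P_t(landedFourAdj n N)`** of the bridge;
* `fourGlueFramesAdj q`, `fourGlueExtFramesAdj q`, `sepFourAdj_glue_subset_arcFourArm`,
  `sepFourAdj_glueExt_subset_arcFourArm` — **gluing and extension land in the host**
  `arcFourArm 0 3`, with the inner landing of the first fenced event and the outer landing given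
  by the cone.

## References

* P. Nolin, Near-critical percolation in two dimensions, *Electron. J. Probab.* 13 (2008), §4.2
  (Def. 6–8), §4.3 (Thm. 11, Prop. 12) [arXiv 0711.4948: Def. 6–7, Thm. 10, Prop. 11] [Nolin2008].
* H. Kesten, Scaling relations for 2D-percolation, *Comm. Math. Phys.* 109 (1987), Lemmas 4–6
  (fences, extension, gluing) [KestenScalingCMP1987].
* W. Werner, *Lectures on two-dimensional critical percolation*, PCMI 16 (2009), Lecture 6, §4
  (first exercise session: separation of arms) [WernerPCMI2009].

## Mathlib / tree

Tree: `sepArmAt`, `sepOpenArmIn`, `mem_sepOpenArmIn_inter_support`, `sepConeSupport`,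
`mem_sepConeSupport`, `sepInnerFence_subset_sepConeSupport`, `readFrame`, `fourGlue`,
`fourGlueExt`, `fourGluePiece_*`, `glueRegion`, `glueZone`, `glueZone_disjoint`,
`image_rot_eq_glueZone`, `exists_glueSlab`, `PathIn.relay`, `triStrip_subset_glueRegion`,
`determinedBy_sepArmAt`, `isUpperSet_sepArmAt_true`, `isLowerSet_sepArmAt_false`
(`ArmSeparationFourArm.lean`); `sepLanding`, `sepInnerFence`, `sepOuterFence`,
`lt_triNorm_of_mem_sepOuterFence`, `triAnnSet` (`ArmSeparation.lean`, `ArmSeparationGlue.lean`);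
`pathIn_of_rotConfig_colour`, `triNorm_eq_apply_zero`, `triNorm_le_iff_lin`, `le_triNorm_iff_lin`;
`hexSide`, `image_rot_hexSide`, `mem_hexSide_zero`, `coord_of_mem_hexSide_one/three/four`,
`mem_hexSide_zero_of_adj_cone` (`LandedAltFourArm.lean`); `arcFourArm`, `mem_arcFourArm_of_pathIn`,
`hexSector` (`ArcLandedFourArm.lean`, `AdjFourArmCyclic.lean`); `landedFourAdj`, `adjFourArm`
(`ArmPatternsFourArm.lean`); `adjFourArm_subset_adjFourArmCyc`.
-/

noncomputable section

open MeasureTheory Set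

namespace Literature.Probability.Percolation

open LatticeModels

/-! ### The fenced four-arm event with adjacent colours -/

/-- **Two disjoint fenced arms of colour `b` landing on the consecutive sides `i`, `i + 1`**
(compare `sepArmPair`: opposite sides): disjoint confining sets `X`, `Y` carrying a fenced arm of
colour `b` landing on side `i` and one landing on side `i + 1`. [cite: Nolin2008, §4.2, well-separated arm events with landing areas (arXiv 0711.4948: Def. 6–8)] -/
def sepArmDuo (i : ℕ) (b : Bool) (n N : ℕ) : Set (SiteConfig (Site 2)) :=
  {ω | ∃ X Y : Set (Site 2), Disjoint X Y ∧ ω ∈ sepArmAt i b X n N ∧ ω ∈ sepArmAt (i + 1) b Y n N}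

/-- **The well-separated four-arm event with ADJACENT colours**, Nolin's
`Ã̃^{η,I/η',I'}_{4,BBWW}(n, N)` with `η = η' = 1/64` and the landing sequences "middle halves of the
sides `0, 1` (open), `3, 4` (closed)" of `∂Λ_n`, `∂Λ_N` (relaxed as in `sepOpenArm`): two disjoint
fenced open arms landing on the sides `0`, `1` and two disjoint fenced closed arms landing on the
sides `3`, `4`. The target of the separation theorem for the adjacent arrangement. [cite: Nolin2008, §4.2 Def. 8 and §4.3 Thm. 11 (arXiv 0711.4948: Def. 7, Thm. 10), for σ = BBWW] -/
def sepFourAdj (n N : ℕ) : Set (SiteConfig (Site 2)) := sepArmDuo 0 true n N ∩ sepArmDuo 3 false n N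

/-- Two disjoint fenced open arms on consecutive sides form an increasing event. [folklore] -/
theorem isUpperSet_sepArmDuo_true (i n N : ℕ) : IsUpperSet (sepArmDuo i true n N) := by
  rintro ω ω' hle ⟨X, Y, hXY, hX, hY⟩
  exact ⟨X, Y, hXY, isUpperSet_sepArmAt_true i X n N hle hX, isUpperSet_sepArmAt_true _ Y n N hle hY⟩

/-- Two disjoint fenced closed arms on consecutive sides form a decreasing event. [folklore] -/
theorem isLowerSet_sepArmDuo_false (i n N : ℕ) : IsLowerSet (sepArmDuo i false n N) := by
  rintro ω ω' hle ⟨X, Y, hXY, hX, hY⟩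
  exact ⟨X, Y, hXY, isLowerSet_sepArmAt_false i X n N hle hX, isLowerSet_sepArmAt_false _ Y n N hle hY⟩

/-- Locality of `sepArmDuo`: determined by `ρ^i(S) ∪ ρ^{i+1}(S)`, `S = sepConeSupport n N`
(`4 ≤ n ≤ N`). [folklore] -/
theorem determinedBy_sepArmDuo (i : ℕ) (b : Bool) {n N : ℕ} (h4 : 4 ≤ n) (hnN : n ≤ N) :
    DeterminedBy (sepArmDuo i b n N)
      (triRotIsoPow i '' sepConeSupport n N ∪ triRotIsoPow (i + 1) '' sepConeSupport n N) := by
  have h : sepArmDuo i b n N = ⋃ X : Set (Site 2), ⋃ Y : Set (Site 2), ⋃ (_ : Disjoint X Y),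
      (sepArmAt i b X n N ∩ sepArmAt (i + 1) b Y n N) := by
    ext ω
    simp only [sepArmDuo, mem_setOf_eq, mem_iUnion, mem_inter_iff, exists_prop]
  rw [h]
  refine DeterminedBy.iUnion fun X => DeterminedBy.iUnion fun Y => DeterminedBy.iUnion fun _ => ?_
  exact ((determinedBy_sepArmAt i b X h4 hnN).mono subset_union_left).inter
    ((determinedBy_sepArmAt (i + 1) b Y h4 hnN).mono subset_union_right)

/-! ### The gluing lemmas with the inner free space recorded (frame of side `0`) -/

-- many `linarith` calls on a large context: the default limits are exceeded by a small factor
set_option maxHeartbeats 1600000 in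
set_option maxRecDepth 4096 in
/-- **The staircase, with the inner free space recorded** (frame of side `0`; the statement of
`sepOpenArmIn_glue_core` with its starting site exported as the bottom site of the inner free
space `sepInnerFence n₁ z'` of the arm, `z' ∈ sepLanding n₁` — the proof is verbatim, the path
being prolonged backwards through the vertical crossing of the free space). A fenced open arm across `Λ_{64q} ∖ Λ_{n₁}` confined to
`X` and the first `39` pieces of the gluing event give an open path, inside
`(X ∩ sepConeSupport n₁ (64q)) ∪ glueRegion q`, from a site `u` of `Λ_{n₁}` to the starting site
`x` (column `256q`) of the open horizontal crossing of the last box `38`, which ends at a site `y`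
of the column `512Q - 1`: the outer free space of the arm is crossed horizontally by one of the
`33` thin boxes (`exists_glueSlab`), which meets the tube `33`, which meets box `34`, …, box `38`
(`PathIn.relay` at each junction). [cite: Nolin2008, §4.3 Prop. 12 (proof) (arXiv 0711.4948: Prop. 11)] -/
theorem sepOpenArmIn_glue_core_fence {q n₁ : ℕ} (hq : 1 ≤ q) (h4 : 4 ≤ n₁) (h₁ : n₁ ≤ 64 * q)
    {X : Set (Site 2)} {ω : SiteConfig (Site 2)} (hA : ω ∈ sepOpenArmIn X n₁ (64 * q))
    (hG : ∀ k < 39, ω ∈ fourGluePiece q k) :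
    ∃ z' u x y : Site 2, z' ∈ sepLanding n₁ ∧ u ∈ sepInnerFence n₁ z' ∧
      x 0 = 256 * (q : ℤ) ∧ y 0 = 512 * ((q : ℤ) + 1) - 1 ∧
      PathIn triGraph ((X ∩ sepConeSupport n₁ (64 * q) ∪ glueRegion q) ∩ ω) u x ∧
      PathIn triGraph (triStrip (256 * (q : ℤ)) (-(192 * (q : ℤ))) (256 * q + 511) (64 * q) ∩ ω) x y := by
  obtain ⟨z, z', u, u', hz, hz', hVin, hVout, hJ⟩ := mem_sepOpenArmIn_inter_support h4 h₁ hA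
  set S := sepConeSupport n₁ (64 * q) with hS
  set T : Set (Site 2) := (X ∩ S ∪ glueRegion q) ∩ ω with hT
  -- integer divisions at the exactly divisible scale
  have e4 : 64 * q / 4 = 16 * q := by omega
  have e8 : 64 * q / 8 = 8 * q := by omega
  have e64 : 64 * q / 64 = q := by omega
  have hq' : (1 : ℤ) ≤ q := by exact_mod_cast hq
  -- the landing row `t = z 1`
  have hzL := hz
  rw [mem_sepLanding, e4] at hzL
  obtain ⟨hz0, hz1, hz2⟩ := hzL
  push_cast at hz0 hz1 hz2
  -- the slab through the outer free space
  obtain ⟨k, hk, hk1, hk2⟩ := exists_glueSlab (s := q) hq (t := z 1) (by linarith) (by linarith)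
  -- the crossings
  have hH : ω ∈ triHCross (64 * (q : ℤ) + 1) (((k : ℤ) - 48) * q) (16 * q) q := by
    rw [← fourGluePiece_lt hk]; exact hG k (by omega)
  have hV : ω ∈ triVCross (72 * (q : ℤ)) (-(49 * (q : ℤ))) (8 * q) (35 * q) := by
    rw [← fourGluePiece_33]; exact hG 33 (by norm_num)
  have hB₀ : ω ∈ triHCross (72 * (q : ℤ)) (-(48 * (q : ℤ))) (64 * q) (16 * q) := by
    rw [← fourGluePiece_34]; exact hG 34 (by norm_num)
  have hV₀ : ω ∈ triVCross (128 * (q : ℤ)) (-(96 * (q : ℤ))) (8 * q) (64 * q) := by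
    rw [← fourGluePiece_35]; exact hG 35 (by norm_num)
  have hB₁ : ω ∈ triHCross (128 * (q : ℤ)) (-(96 * (q : ℤ))) (136 * q) (32 * q) := by
    rw [← fourGluePiece_36]; exact hG 36 (by norm_num)
  have hV₁ : ω ∈ triVCross (256 * (q : ℤ)) (-(192 * (q : ℤ))) (8 * q) (128 * q) := by
    rw [← fourGluePiece_37]; exact hG 37 (by norm_num)
  have hB₂ : ω ∈ triHCross (256 * (q : ℤ)) (-(192 * (q : ℤ))) (256 * q + 511) (64 * q) := by
    rw [← fourGluePiece_38]; exact hG 38 (by norm_num)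
  obtain ⟨xH, yH, hxH, hyH, pH⟩ := hH
  obtain ⟨c, d, hc, hd, pV⟩ := hV
  obtain ⟨x₀, y₀, hx₀, hy₀, pB₀⟩ := hB₀
  obtain ⟨c₀, d₀, hc₀, hd₀, pV₀⟩ := hV₀
  obtain ⟨x₁, y₁, hx₁, hy₁, pB₁⟩ := hB₁
  obtain ⟨c₁, d₁, hc₁, hd₁, pV₁⟩ := hV₁
  obtain ⟨x₂, y₂, hx₂, hy₂, pB₂⟩ := hB₂
  push_cast at hyH hd hy₀ hd₀ hy₁ hd₁ hy₂
  -- the outer fence crossing of the arm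
  rw [e64] at hVout
  obtain ⟨b₁, t₁, hb₁, ht₁, pF₁, pF₁'⟩ := hVout
  have pW : PathIn triGraph (sepOuterFence (64 * q) z ∩ (X ∩ S) ∩ ω) b₁ t₁ := pF₁.trans pF₁'
  have hk' : ((k - 48 : ℤ)) * q = (-48 + (k : ℤ)) * q := by ring
  rw [hk'] at pH
  -- junction 1: the thin box `k` and the outer free space of the arm
  have J₁ := PathIn.relay (L := 64 * (q : ℤ) + 1) (R := 72 * (q : ℤ)) (B := z 1 - q) (T := z 1 + q)
    (by linarith) (by linarith) pH (by rw [hxH]) (by rw [hyH]; linarith)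
    (fun w hw _ _ => by rw [mem_triStrip] at hw; push_cast at hw; constructor <;> linarith)
    pW (by rw [hb₁]) (by rw [ht₁])
    (fun w hw _ _ => by rw [mem_inter_iff, mem_sepOuterFence, e8] at hw; push_cast at hw; constructor <;> linarith)
  -- junction 2: the thin box `k` and the tube `33`
  have J₂ := PathIn.relay (L := 72 * (q : ℤ)) (R := 80 * (q : ℤ)) (B := (-48 + (k : ℤ)) * q)
    (T := (-48 + (k : ℤ)) * q + q) (by linarith) (by linarith) pH (by rw [hxH]; linarith) (by rw [hyH]; linarith)
    (fun w hw _ _ => by rw [mem_triStrip] at hw; push_cast at hw; constructor <;> linarith)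
    pV (by rw [hc]; linarith) (by rw [hd]; linarith)
    (fun w hw _ _ => by rw [mem_triStrip] at hw; push_cast at hw; constructor <;> linarith)
  -- junction 3: box `34` and the tube `33`
  have J₃ := PathIn.relay (L := 72 * (q : ℤ)) (R := 80 * (q : ℤ)) (B := -(48 * (q : ℤ))) (T := -(32 * (q : ℤ)))
    (by linarith) (by linarith) pB₀ (by rw [hx₀]) (by rw [hy₀]; linarith)
    (fun w hw _ _ => by rw [mem_triStrip] at hw; push_cast at hw; constructor <;> linarith)
    pV (by rw [hc]; linarith) (by rw [hd]; linarith)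
    (fun w hw _ _ => by rw [mem_triStrip] at hw; push_cast at hw; constructor <;> linarith)
  -- junction 4: box `34` and the tube `35`
  have J₄ := PathIn.relay (L := 128 * (q : ℤ)) (R := 136 * (q : ℤ)) (B := -(48 * (q : ℤ))) (T := -(32 * (q : ℤ)))
    (by linarith) (by linarith) pB₀ (by rw [hx₀]; linarith) (by rw [hy₀]; linarith)
    (fun w hw _ _ => by rw [mem_triStrip] at hw; push_cast at hw; constructor <;> linarith)
    pV₀ (by rw [hc₀]; linarith) (by rw [hd₀]; linarith)
    (fun w hw _ _ => by rw [mem_triStrip] at hw; push_cast at hw; constructor <;> linarith)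
  -- junction 5: box `36` and the tube `35`
  have J₅ := PathIn.relay (L := 128 * (q : ℤ)) (R := 136 * (q : ℤ)) (B := -(96 * (q : ℤ))) (T := -(64 * (q : ℤ)))
    (by linarith) (by linarith) pB₁ (by rw [hx₁]) (by rw [hy₁]; linarith)
    (fun w hw _ _ => by rw [mem_triStrip] at hw; push_cast at hw; constructor <;> linarith)
    pV₀ (by rw [hc₀]) (by rw [hd₀]; linarith)
    (fun w hw _ _ => by rw [mem_triStrip] at hw; push_cast at hw; constructor <;> linarith)
  -- junction 6: box `36` and the tube `37`
  have J₆ := PathIn.relay (L := 256 * (q : ℤ)) (R := 264 * (q : ℤ)) (B := -(96 * (q : ℤ))) (T := -(64 * (q : ℤ)))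
    (by linarith) (by linarith) pB₁ (by rw [hx₁]; linarith) (by rw [hy₁]; linarith)
    (fun w hw _ _ => by rw [mem_triStrip] at hw; push_cast at hw; constructor <;> linarith)
    pV₁ (by rw [hc₁]; linarith) (by rw [hd₁]; linarith)
    (fun w hw _ _ => by rw [mem_triStrip] at hw; push_cast at hw; constructor <;> linarith)
  -- junction 7: box `38` and the tube `37`
  have J₇ := PathIn.relay (L := 256 * (q : ℤ)) (R := 264 * (q : ℤ)) (B := -(192 * (q : ℤ))) (T := -(128 * (q : ℤ)))
    (by linarith) (by linarith) pB₂ (by rw [hx₂]) (by rw [hy₂]; linarith)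
    (fun w hw _ _ => by rw [mem_triStrip] at hw; push_cast at hw; constructor <;> linarith)
    pV₁ (by rw [hc₁]) (by rw [hd₁]; linarith)
    (fun w hw _ _ => by rw [mem_triStrip] at hw; push_cast at hw; constructor <;> linarith)
  -- the regions
  have gH : triStrip (64 * (q : ℤ) + 1) ((-48 + (k : ℤ)) * q) (16 * q) q ⊆ glueRegion q := by
    exact triStrip_subset_glueRegion (by linarith) (by push_cast; linarith) (by linarith) (by linarith)
  have gV : triStrip (72 * (q : ℤ)) (-(49 * (q : ℤ))) (8 * q) (35 * q) ⊆ glueRegion q :=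
    triStrip_subset_glueRegion (by linarith) (by push_cast; linarith) (by push_cast; linarith) (by linarith)
  have gB₀ : triStrip (72 * (q : ℤ)) (-(48 * (q : ℤ))) (64 * q) (16 * q) ⊆ glueRegion q :=
    triStrip_subset_glueRegion (by linarith) (by push_cast; linarith) (by push_cast; linarith) (by linarith)
  have gV₀ : triStrip (128 * (q : ℤ)) (-(96 * (q : ℤ))) (8 * q) (64 * q) ⊆ glueRegion q :=
    triStrip_subset_glueRegion (by linarith) (by push_cast; linarith) (by push_cast; linarith) (by linarith)
  have gB₁ : triStrip (128 * (q : ℤ)) (-(96 * (q : ℤ))) (136 * q) (32 * q) ⊆ glueRegion q :=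
    triStrip_subset_glueRegion (by linarith) (by push_cast; linarith) (by push_cast; linarith) (by linarith)
  have gV₁ : triStrip (256 * (q : ℤ)) (-(192 * (q : ℤ))) (8 * q) (128 * q) ⊆ glueRegion q :=
    triStrip_subset_glueRegion (by linarith) (by push_cast; linarith) (by push_cast; linarith) (by linarith)
  have gB₂ : triStrip (256 * (q : ℤ)) (-(192 * (q : ℤ))) (256 * q + 511) (64 * q) ⊆ glueRegion q :=
    triStrip_subset_glueRegion (by linarith) (by push_cast; linarith) (by push_cast; linarith) (by linarith)
  have mXS : ∀ F : Set (Site 2), F ∩ (X ∩ S) ∩ ω ⊆ T := fun F v hv => ⟨Or.inl hv.1.2, hv.2⟩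
  have mG : ∀ {F : Set (Site 2)}, F ⊆ glueRegion q → F ∩ ω ⊆ T := fun hF v hv => ⟨Or.inr (hF hv.1), hv.2⟩
  have mG2 : ∀ {F F' : Set (Site 2)}, F ⊆ glueRegion q → F' ⊆ glueRegion q → (F ∪ F') ∩ ω ⊆ T := by
    intro F F' hF hF' v hv
    rcases hv.1 with h | h
    · exact ⟨Or.inr (hF h), hv.2⟩
    · exact ⟨Or.inr (hF' h), hv.2⟩
  have m₁ : (triStrip (64 * (q : ℤ) + 1) ((-48 + (k : ℤ)) * q) (16 * q) q ∪
      sepOuterFence (64 * q) z ∩ (X ∩ S)) ∩ ω ⊆ T := by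
    intro v hv
    rcases hv.1 with h | h
    · exact ⟨Or.inr (gH h), hv.2⟩
    · exact ⟨Or.inl h.2, hv.2⟩
  -- the open path from the inner free space of the arm to the start of the crossing of box `38`
  have P : PathIn triGraph T u x₂ :=
    (hJ.mono (mXS _)) |>.trans (pF₁.symm.mono (mXS _)) |>.trans (J₁.symm.mono m₁)
      |>.trans (J₂.mono (mG2 gH gV)) |>.trans (J₃.symm.mono (mG2 gB₀ gV)) |>.trans (J₄.mono (mG2 gB₀ gV₀))
      |>.trans (J₅.symm.mono (mG2 gB₁ gV₀)) |>.trans (J₆.mono (mG2 gB₁ gV₁)) |>.trans (J₇.symm.mono (mG2 gB₂ gV₁))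
  obtain ⟨b₀, t₀, -, -, pF₀, -⟩ := hVin
  exact ⟨z', b₀, x₂, y₂, hz', pF₀.left_mem.1.1, hx₂, by rw [hy₂]; ring, (pF₀.mono (mXS _)).trans P, pB₂⟩

/-- **Extension, with the inner free space recorded** (frame of side `0`; `sepOpenArmIn_glueExt_path`
with the starting site in the inner free space). A fenced open arm across `Λ_{64q} ∖ Λ_{n₁}` confined to
`X` and the extension event `fourGlueExt q` give an open path inside
`(X ∩ sepConeSupport n₁ (64q)) ∪ glueRegion q` from a site of `Λ_{n₁}` to a site of graph norm
`512Q - 1` (Nolin 2008, Prop. 12 (i): "once well-separated, the arms can easily be extended"). [cite: Nolin2008, §4.3 Prop. 12 (proof) (arXiv 0711.4948: Prop. 11)] -/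
theorem sepOpenArmIn_glueExt_path_fence {q n₁ : ℕ} (hq : 1 ≤ q) (h4 : 4 ≤ n₁) (h₁ : n₁ ≤ 64 * q)
    {X : Set (Site 2)} {ω : SiteConfig (Site 2)} (hA : ω ∈ sepOpenArmIn X n₁ (64 * q))
    (hG : ω ∈ fourGlueExt q) :
    ∃ z' u y : Site 2, z' ∈ sepLanding n₁ ∧ u ∈ sepInnerFence n₁ z' ∧
      triNorm y = 512 * ((q : ℤ) + 1) - 1 ∧
      PathIn triGraph ((X ∩ sepConeSupport n₁ (64 * q) ∪ glueRegion q) ∩ ω) u y := by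
  have hG' : ∀ k < 39, ω ∈ fourGluePiece q k := by
    intro k hk
    simp only [fourGlueExt, mem_iInter, Finset.mem_range] at hG
    exact hG k hk
  obtain ⟨z', u, x, y, hz', hu, -, hy, P, pB⟩ := sepOpenArmIn_glue_core_fence hq h4 h₁ hA hG'
  have hq' : (1 : ℤ) ≤ q := by exact_mod_cast hq
  have gB : triStrip (256 * (q : ℤ)) (-(192 * (q : ℤ))) (256 * q + 511) (64 * q) ⊆ glueRegion q :=
    triStrip_subset_glueRegion (by linarith) (by push_cast; linarith) (by push_cast; linarith) (by linarith)
  have hyR : y ∈ glueRegion q := gB pB.right_mem.1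
  refine ⟨z', u, y, hz', hu, by rw [triNorm_eq_of_mem_glueRegion hyR, hy], P.trans (pB.mono ?_)⟩
  exact fun v hv => ⟨Or.inr (gB hv.1), hv.2⟩


-- many `linarith` calls on a large context
set_option maxHeartbeats 1600000 in
set_option maxRecDepth 4096 in
/-- **Gluing, with the inner free space recorded** (one open arm, frame of side `0`;
`sepOpenArmIn_glue_path` with the starting site in the inner free space). A fenced open arm across `Λ_{64q} ∖ Λ_{n₁}`
confined to `X`, the gluing event `fourGlue q` and a fenced open arm across `Λ_{n₃} ∖ Λ_{512Q}`
confined to `X'` give an open path inside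
`(X ∩ sepConeSupport n₁ (64q)) ∪ glueRegion q ∪ (X' ∩ sepConeSupport (512Q) n₃)` from a site of
`Λ_{n₁}` to a site outside `Λ_{n₃}`: the staircase (`sepOpenArmIn_glue_core`) is continued through
the tube `39` and one of the `33` boxes at scale `512Q`, which crosses the inner free space of the
second arm (Nolin 2008, proof of Prop. 12 (ii) [arXiv Prop. 11]; Kesten 1987, fences). [cite: Nolin2008, §4.3 Prop. 12 (proof) (arXiv 0711.4948: Prop. 11)] -/
theorem sepOpenArmIn_glue_path_fence {q n₁ n₃ : ℕ} (hq : 1 ≤ q) (h4 : 4 ≤ n₁) (h₁ : n₁ ≤ 64 * q)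
    (h₃ : 512 * (q + 1) ≤ n₃) {X X' : Set (Site 2)} {ω : SiteConfig (Site 2)}
    (hA : ω ∈ sepOpenArmIn X n₁ (64 * q)) (hG : ω ∈ fourGlue q)
    (hA' : ω ∈ sepOpenArmIn X' (512 * (q + 1)) n₃) :
    ∃ z' u u' : Site 2, z' ∈ sepLanding n₁ ∧ u ∈ sepInnerFence n₁ z' ∧ (n₃ : ℤ) < triNorm u' ∧
      PathIn triGraph ((X ∩ sepConeSupport n₁ (64 * q) ∪ glueRegion q ∪
        X' ∩ sepConeSupport (512 * (q + 1)) n₃) ∩ ω) u u' := by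
  have hGk : ∀ k < 73, ω ∈ fourGluePiece q k := by
    intro k hk
    simp only [fourGlue, mem_iInter, Finset.mem_range] at hG
    exact hG k hk
  obtain ⟨z', u, x₂, y₂, hz', hu, hx₂, hy₂, P, pB₂⟩ :=
    sepOpenArmIn_glue_core_fence hq h4 h₁ hA (fun k hk => hGk k (by omega))
  obtain ⟨Z, Z', U, U', hZ, hZ', hVin₂, hVout₂, hJ₂⟩ :=
    mem_sepOpenArmIn_inter_support (by omega) h₃ hA'
  set S := sepConeSupport n₁ (64 * q) with hS
  set S' := sepConeSupport (512 * (q + 1)) n₃ with hS'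
  set T : Set (Site 2) := (X ∩ S ∪ glueRegion q ∪ X' ∩ S') ∩ ω with hT
  have E4 : 512 * (q + 1) / 4 = 128 * (q + 1) := by omega
  have E8 : 512 * (q + 1) / 8 = 64 * (q + 1) := by omega
  have E64 : 512 * (q + 1) / 64 = 8 * (q + 1) := by omega
  have hq' : (1 : ℤ) ≤ q := by exact_mod_cast hq
  -- the landing row `t' = Z' 1`
  have hZL := hZ'
  rw [mem_sepLanding, E4] at hZL
  obtain ⟨hZ0, hZ1, hZ2⟩ := hZL
  push_cast at hZ0 hZ1 hZ2
  obtain ⟨k', hk', hk1', hk2'⟩ := exists_glueSlab (s := 8 * (q + 1)) (by omega) (t := Z' 1)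
    (by push_cast; linarith) (by push_cast; linarith)
  push_cast at hk1' hk2'
  -- the crossings
  have hV' : ω ∈ triVCross (432 * ((q : ℤ) + 1) - 1) (-(392 * ((q : ℤ) + 1) + 1)) (8 * (q + 1)) (392 * (q + 1)) := by
    rw [← fourGluePiece_39]; exact hGk 39 (by norm_num)
  have hH' : ω ∈ triHCross (432 * ((q : ℤ) + 1) - 1) ((-48 + (k' : ℤ)) * (8 * ((q : ℤ) + 1)))
      (80 * (q + 1)) (8 * (q + 1)) := by
    have h := hGk (40 + k') (by omega)
    rw [fourGluePiece_ge (by omega)] at h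
    have e : (((40 + k' : ℕ) : ℤ) - 88) * (8 * ((q : ℤ) + 1)) = (-48 + (k' : ℤ)) * (8 * ((q : ℤ) + 1)) := by
      push_cast; ring
    rwa [e] at h
  obtain ⟨c', d', hc', hd', pV'⟩ := hV'
  obtain ⟨xH, yH, hxH, hyH, pH'⟩ := hH'
  push_cast at hd' hyH
  -- the inner fence crossing of the second arm
  rw [E64] at hVin₂
  obtain ⟨b₂, t₂, hb₂, ht₂, pF₂, pF₂'⟩ := hVin₂
  have pW₂ : PathIn triGraph (sepInnerFence (512 * (q + 1)) Z' ∩ (X' ∩ S') ∩ ω) b₂ t₂ := pF₂.trans pF₂'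
  push_cast at hb₂ ht₂
  -- junction 8: box `38` and the tube `39`
  have J₈ := PathIn.relay (L := 432 * ((q : ℤ) + 1) - 1) (R := 440 * ((q : ℤ) + 1) - 1)
    (B := -(192 * (q : ℤ))) (T := -(128 * (q : ℤ))) (by linarith) (by linarith) pB₂ (by rw [hx₂]; linarith)
    (by rw [hy₂]; linarith)
    (fun w hw _ _ => by rw [mem_triStrip] at hw; push_cast at hw; constructor <;> linarith)
    pV' (by rw [hc']; linarith) (by rw [hd']; linarith)
    (fun w hw _ _ => by rw [mem_triStrip] at hw; push_cast at hw; constructor <;> linarith)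
  -- junction 9: the box `k'` at scale `512Q` and the tube `39`
  have J₉ := PathIn.relay (L := 432 * ((q : ℤ) + 1) - 1) (R := 440 * ((q : ℤ) + 1) - 1)
    (B := (-48 + (k' : ℤ)) * (8 * ((q : ℤ) + 1))) (T := (-48 + (k' : ℤ)) * (8 * ((q : ℤ) + 1)) + 8 * ((q : ℤ) + 1))
    (by linarith) (by linarith) pH' (by rw [hxH]) (by rw [hyH]; linarith)
    (fun w hw _ _ => by rw [mem_triStrip] at hw; push_cast at hw; constructor <;> linarith)
    pV' (by rw [hc']; linarith) (by rw [hd']; linarith)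
    (fun w hw _ _ => by rw [mem_triStrip] at hw; push_cast at hw; constructor <;> linarith)
  -- junction 10: the box `k'` and the inner free space of the second arm
  have J₁₀ := PathIn.relay (L := 448 * ((q : ℤ) + 1)) (R := 512 * ((q : ℤ) + 1) - 1)
    (B := Z' 1 - 8 * ((q : ℤ) + 1)) (T := Z' 1 + 8 * ((q : ℤ) + 1)) (by linarith) (by linarith) pH'
    (by rw [hxH]; linarith) (by rw [hyH]; linarith)
    (fun w hw _ _ => by rw [mem_triStrip] at hw; push_cast at hw; constructor <;> linarith)
    pW₂ (by rw [hb₂]) (by rw [ht₂])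
    (fun w hw _ _ => by
      rw [mem_inter_iff, mem_sepInnerFence, E8] at hw; push_cast at hw; constructor <;> linarith)
  -- the regions
  have gB₂ : triStrip (256 * (q : ℤ)) (-(192 * (q : ℤ))) (256 * q + 511) (64 * q) ⊆ glueRegion q :=
    triStrip_subset_glueRegion (by linarith) (by push_cast; linarith) (by push_cast; linarith) (by linarith)
  have gV' : triStrip (432 * ((q : ℤ) + 1) - 1) (-(392 * ((q : ℤ) + 1) + 1)) (8 * (q + 1)) (392 * (q + 1)) ⊆
      glueRegion q :=
    triStrip_subset_glueRegion (by linarith) (by push_cast; linarith) (by push_cast; linarith) (by linarith)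
  have gH' : triStrip (432 * ((q : ℤ) + 1) - 1) ((-48 + (k' : ℤ)) * (8 * ((q : ℤ) + 1))) (80 * (q + 1))
      (8 * (q + 1)) ⊆ glueRegion q :=
    triStrip_subset_glueRegion (by linarith) (by push_cast; linarith) (by push_cast; linarith) (by linarith)
  have mG2 : ∀ {F F' : Set (Site 2)}, F ⊆ glueRegion q → F' ⊆ glueRegion q → (F ∪ F') ∩ ω ⊆ T := by
    intro F F' hF hF' v hv
    rcases hv.1 with h | h
    · exact ⟨Or.inl (Or.inr (hF h)), hv.2⟩
    · exact ⟨Or.inl (Or.inr (hF' h)), hv.2⟩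
  have m₁₀ : (triStrip (432 * ((q : ℤ) + 1) - 1) ((-48 + (k' : ℤ)) * (8 * ((q : ℤ) + 1))) (80 * (q + 1)) (8 * (q + 1)) ∪
      sepInnerFence (512 * (q + 1)) Z' ∩ (X' ∩ S')) ∩ ω ⊆ T := by
    intro v hv
    rcases hv.1 with h | h
    · exact ⟨Or.inl (Or.inr (gH' h)), hv.2⟩
    · exact ⟨Or.inr h.2, hv.2⟩
  have mXS' : ∀ F : Set (Site 2), F ∩ (X' ∩ S') ∩ ω ⊆ T := fun F v hv => ⟨Or.inr hv.1.2, hv.2⟩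
  have mT : (X ∩ S ∪ glueRegion q) ∩ ω ⊆ T := fun v hv => ⟨Or.inl hv.1, hv.2⟩
  have P' : PathIn triGraph T u U' :=
    (P.mono mT) |>.trans (J₈.mono (mG2 gB₂ gV')) |>.trans (J₉.symm.mono (mG2 gH' gV')) |>.trans (J₁₀.mono m₁₀)
      |>.trans (pF₂.mono (mXS' _)) |>.trans (hJ₂.mono (mXS' _))
  obtain ⟨B₀, T₀, -, -, pG₀, -⟩ := hVout₂
  exact ⟨z', u, U', hz', hu, lt_triNorm_of_mem_sepOuterFence pG₀.right_mem.1.1, P'⟩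


/-! ### Trimming to an arm landed at both ends -/

/-- **A site of an inner free space lies strictly inside `Λ_n`**: for `z' ∈ sepLanding n` and
`u ∈ sepInnerFence n z'`, `u` lies in the closed cone `{x₁ ≤ 0 ≤ x₀ + x₁}`, so that
`|u|_𝕋 = u₀ ≤ n - 1`. (Compare `triNorm_le_of_mem_sepInnerFence`.) [cite: Nolin2008, §4.2, free spaces on the internal boundary (arXiv 0711.4948: Def. 6–7: "the free spaces are included in S_n")] -/
theorem triNorm_lt_of_mem_sepInnerFence {n : ℕ} {z' u : Site 2} (hz' : z' ∈ sepLanding n)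
    (hu : u ∈ sepInnerFence n z') : triNorm u < n := by
  rw [mem_sepLanding] at hz'
  rw [mem_sepInnerFence] at hu
  rw [triNorm_lt_iff_lin]
  omega

/-- **How an arm is seen to start on side `0`.** A site `x` of `∂Λ_r` adjacent to a site `a` of
graph norm `r - 1` lying in the open cone over side `0` lies on side `0` (the inner twin of
`mem_hexSide_zero_of_adj_cone`). [folklore] -/
theorem mem_hexSide_zero_of_adj_cone_inner {r : ℕ} {x a : Site 2} (hx : triNorm x = r)
    (ha : triNorm a + 1 = r) (hc : 0 < a 0 ∧ a 1 < 0 ∧ 0 < a 0 + a 1) (hadj : triGraph.Adj a x) :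
    x ∈ hexSide r 0 := by
  have ha0 : a 0 + 1 = r := by rw [← ha, triNorm_eq_apply_zero hc.2.1.le hc.2.2.le]
  have hxle := triNorm_le_iff_lin.1 hx.le
  have hxge := le_triNorm_iff_lin.1 hx.ge
  rw [mem_hexSide_zero]
  rcases (triGraph_adj_iff_coord a x).1 hadj with h | h | h | h | h | h <;> omega

/-- **Trimming to an arm landed at both ends.** A `𝕋`-path inside `Z ∩ ω` from a site strictly
inside `Λ_r` to a site outside `Λ_R` (`1 ≤ r ≤ R`), where the sites of `Z` beyond `∂Λ_R` AND those
strictly inside `Λ_r` lie in the open cone over side `0`, contains an arm of `{r ≤ |·|_𝕋 ≤ R}`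
from SIDE `0` of `∂Λ_r` to SIDE `0` of `∂Λ_R`: cut at the first step out of `Λ_R` (as
`PathIn.exists_landedArm`) and at the last step out of `Λ°_r`, whose origin is a cone site of norm
`r - 1` (`mem_hexSide_zero_of_adj_cone_inner`). [folklore] -/
theorem PathIn.exists_dlandedArm {Z ω : Set (Site 2)} {u v : Site 2} {r R : ℕ}
    (h : PathIn triGraph (Z ∩ ω) u v) (hu : triNorm u < r) (hv : (R : ℤ) < triNorm v) (hrR : r ≤ R)
    (hZ : ∀ z ∈ Z, (R : ℤ) < triNorm z → (0 < z 0 ∧ z 1 < 0 ∧ 0 < z 0 + z 1))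
    (hZ' : ∀ z ∈ Z, triNorm z < r → (0 < z 0 ∧ z 1 < 0 ∧ 0 < z 0 + z 1)) :
    ∃ x y : Site 2, x ∈ hexSide r 0 ∧ y ∈ hexSide R 0 ∧
      PathIn triGraph ({w : Site 2 | (r : ℤ) ≤ triNorm w ∧ triNorm w ≤ R} ∩ (Z ∩ ω)) x y := by
  have hrR' : (r : ℤ) ≤ R := by exact_mod_cast hrR
  -- first step out of `Λ_R`
  obtain ⟨a, b, ha, hb, hbA, hab, hua⟩ :=
    h.exit (R := {w : Site 2 | triNorm w ≤ R}) (show triNorm u ≤ (R : ℤ) by omega)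
      (fun hv' => absurd hv (not_lt.2 hv'))
  simp only [mem_setOf_eq, not_le] at ha hb
  have hb1 : triNorm b ≤ triNorm a + 1 := triNorm_le_triNorm_add_one_of_adj hab
  have haR : triNorm a = R := by omega
  have hbR : triNorm b = (R : ℤ) + 1 := by omega
  have haSide : a ∈ hexSide R 0 := mem_hexSide_zero_of_adj_cone haR hbR (hZ b hbA.1 hb) hab
  -- last step out of `Λ°_r`
  rcases hua.last_exit_or (C := {w : Site 2 | triNorm w < r}) hu with har |
    ⟨a', b', ha', ha'A, hb', hab', hp⟩
  · simp only [mem_setOf_eq] at har; omega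
  · simp only [mem_setOf_eq, not_lt] at ha' hb'
    have hb'1 : triNorm b' ≤ triNorm a' + 1 := triNorm_le_triNorm_add_one_of_adj hab'
    have hb'r : triNorm b' = r := by omega
    have ha'r : triNorm a' + 1 = r := by omega
    have hbSide : b' ∈ hexSide r 0 :=
      mem_hexSide_zero_of_adj_cone_inner hb'r ha'r (hZ' a' ha'A.2.1 ha') hab'
    refine ⟨b', a, hbSide, haSide, hp.mono ?_⟩
    rintro w ⟨⟨hw1, hw2⟩, hw3⟩
    simp only [mem_setOf_eq, not_lt] at hw3
    exact ⟨⟨hw3, hw1⟩, hw2⟩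

/-! ### Fenced, glued and extended arms run from side to side -/

/-- **A fenced arm of colour `b` in frame `i` contains an arm from side `i` of `∂Λ_n` to side `i`
of `∂Λ_N`** (`4 ≤ n ≤ N`), inside `X ∩ ρ^i(sepConeSupport n N)`: its vertical crossing of the inner
free space starts strictly inside `Λ_n` in the cone, the arm proper reaches the outer free space
beyond `∂Λ_N` in the cone (`PathIn.exists_dlandedArm` in frame `0`, then `ρ^i`). [cite: Nolin2008, §4.2 Def. 6–8 (arXiv 0711.4948: Def. 6–7: arms attached to free spaces inside S_n and outside S_N)] -/
theorem sepArmAt_dlandedArm {i : ℕ} {b : Bool} {X : Set (Site 2)} {n N : ℕ} (h4 : 4 ≤ n)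
    (hnN : n ≤ N) {ω : SiteConfig (Site 2)} (hA : ω ∈ sepArmAt i b X n N) :
    ∃ x y : Site 2, x ∈ hexSide n i ∧ y ∈ hexSide N i ∧
      PathIn triGraph ((X ∩ triRotIsoPow i '' sepConeSupport n N) ∩ triAnnSet n N ∩
        {v | v ∈ ω ↔ b}) x y := by
  obtain ⟨z, z', u, u', hz, hz', ⟨b₀, t₀, hb₀, -, pF, -⟩, ⟨b₁, t₁, -, -, pG, -⟩, hJ⟩ :=
    mem_sepOpenArmIn_inter_support h4 hnN hA
  set S := sepConeSupport n N with hS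
  set Z : Set (Site 2) := (triRotIsoPow i) ⁻¹' X ∩ S with hZ
  have hcone : ∀ w ∈ Z, (N : ℤ) < triNorm w → (0 < w 0 ∧ w 1 < 0 ∧ 0 < w 0 + w 1) :=
    fun w hw hn => ((mem_sepConeSupport.1 hw.2).2.2 (Or.inr hn))
  have hcone' : ∀ w ∈ Z, triNorm w < n → (0 < w 0 ∧ w 1 < 0 ∧ 0 < w 0 + w 1) :=
    fun w hw hn => ((mem_sepConeSupport.1 hw.2).2.2 (Or.inl hn))
  -- the path: inner free space → attach point → outer free space
  have P₁ : PathIn triGraph (Z ∩ readFrame i b ω) b₀ u := pF.mono fun w hw => ⟨hw.1.2, hw.2⟩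
  have P₂ : PathIn triGraph (Z ∩ readFrame i b ω) u u' := hJ.mono fun w hw => ⟨hw.1.2, hw.2⟩
  have P : PathIn triGraph (Z ∩ readFrame i b ω) b₀ u' := P₁.trans P₂
  have hb₀n : triNorm b₀ < n := triNorm_lt_of_mem_sepInnerFence hz' pF.left_mem.1.1
  have hu'N : (N : ℤ) < triNorm u' := lt_triNorm_of_mem_sepOuterFence pG.right_mem.1.1
  obtain ⟨x₀, y₀, hx₀, hy₀, Q⟩ := PathIn.exists_dlandedArm P hb₀n hu'N hnN hcone hcone'
  have Q' : PathIn triGraph ((triAnnSet n N ∩ Z) ∩ rotConfig i {v : Site 2 | v ∈ ω ↔ b}) x₀ y₀ :=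
    Q.mono fun w hw => ⟨⟨mem_triAnnSet.2 hw.1, hw.2.1⟩, hw.2.2⟩
  have Q'' := pathIn_of_rotConfig_colour i b Q'
  refine ⟨triRotIsoPow i x₀, triRotIsoPow i y₀, ?_, ?_, Q''.mono ?_⟩
  · have : triRotIsoPow i x₀ ∈ triRotIsoPow i '' hexSide n 0 := ⟨x₀, hx₀, rfl⟩
    rwa [image_rot_hexSide, zero_add] at this
  · have : triRotIsoPow i y₀ ∈ triRotIsoPow i '' hexSide N 0 := ⟨y₀, hy₀, rfl⟩
    rwa [image_rot_hexSide, zero_add] at this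
  · rintro w ⟨⟨v, ⟨hvA, hvX, hvS⟩, rfl⟩, hwc⟩
    refine ⟨⟨⟨hvX, v, hvS, rfl⟩, ?_⟩, hwc⟩
    rw [mem_triAnnSet, triNorm_rot]; exact mem_triAnnSet.1 hvA

/-- **The glued arm of colour `b` in frame `i` runs from side `i` of `∂Λ_{n₁}` to side `i` of
`∂Λ_{n₃}`** (as `sepArmAt_glue_path_landed`, with the inner landing from the exported free space
of `sepOpenArmIn_glue_path_fence`). [cite: Nolin2008, §4.3 Prop. 12 (proof) (arXiv 0711.4948: Prop. 11)] -/
theorem sepArmAt_glue_path_dlanded {q n₁ n₃ i : ℕ} {b : Bool} (hq : 1 ≤ q) (h4 : 4 ≤ n₁)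
    (h₁ : n₁ ≤ 64 * q) (h₃ : 512 * (q + 1) ≤ n₃) {X X' : Set (Site 2)} {ω : SiteConfig (Site 2)}
    (hA : ω ∈ sepArmAt i b X n₁ (64 * q)) (hG : readFrame i b ω ∈ fourGlue q)
    (hA' : ω ∈ sepArmAt i b X' (512 * (q + 1)) n₃) :
    ∃ x y : Site 2, x ∈ hexSide n₁ i ∧ y ∈ hexSide n₃ i ∧
      PathIn triGraph (glueZone q n₁ n₃ i X X' ∩ triAnnSet n₁ n₃ ∩ {v | v ∈ ω ↔ b}) x y := by
  obtain ⟨z', u, u', hz', hu, hu', P⟩ := sepOpenArmIn_glue_path_fence hq h4 h₁ h₃ hA hG hA'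
  set Z : Set (Site 2) := (triRotIsoPow i) ⁻¹' X ∩ sepConeSupport n₁ (64 * q) ∪ glueRegion q ∪
    (triRotIsoPow i) ⁻¹' X' ∩ sepConeSupport (512 * (q + 1)) n₃ with hZ
  have h13 : n₁ ≤ n₃ := h₁.trans (le_trans (by omega) h₃)
  have e8 : 64 * q / 8 = 8 * q := by omega
  have E8 : 512 * (q + 1) / 8 = 64 * (q + 1) := by omega
  -- sites of the zone beyond `∂Λ_{n₃}` or strictly inside `Λ_{n₁}` lie in the cone
  have hcone : ∀ w ∈ Z, (n₃ : ℤ) < triNorm w → (0 < w 0 ∧ w 1 < 0 ∧ 0 < w 0 + w 1) := by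
    rintro w ((⟨-, hw⟩ | hw) | ⟨-, hw⟩) hn
    · rw [mem_sepConeSupport, e8] at hw
      push_cast at hw
      omega
    · exact (mem_triCone_of_mem_glueRegion hw).1
    · rw [mem_sepConeSupport, E8] at hw
      exact hw.2.2 (Or.inr hn)
  have hcone' : ∀ w ∈ Z, triNorm w < n₁ → (0 < w 0 ∧ w 1 < 0 ∧ 0 < w 0 + w 1) := by
    rintro w ((⟨-, hw⟩ | hw) | ⟨-, hw⟩) hn
    · rw [mem_sepConeSupport] at hw
      exact hw.2.2 (Or.inl hn)
    · exact (mem_triCone_of_mem_glueRegion hw).1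
    · rw [mem_sepConeSupport, E8] at hw
      push_cast at hw
      omega
  have P' : PathIn triGraph (Z ∩ readFrame i b ω) u u' := P
  have hun : triNorm u < n₁ := triNorm_lt_of_mem_sepInnerFence hz' hu
  obtain ⟨x₀, y₀, hx₀, hy₀, Q⟩ := PathIn.exists_dlandedArm P' hun hu' h13 hcone hcone'
  have Q' : PathIn triGraph (({w : Site 2 | (n₁ : ℤ) ≤ triNorm w ∧ triNorm w ≤ n₃} ∩ Z) ∩
      rotConfig i {v : Site 2 | v ∈ ω ↔ b}) x₀ y₀ :=
    Q.mono fun w hw => ⟨⟨hw.1, hw.2.1⟩, hw.2.2⟩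
  have Q'' := pathIn_of_rotConfig_colour i b Q'
  refine ⟨triRotIsoPow i x₀, triRotIsoPow i y₀, ?_, ?_, Q''.mono ?_⟩
  · have : triRotIsoPow i x₀ ∈ triRotIsoPow i '' hexSide n₁ 0 := ⟨x₀, hx₀, rfl⟩
    rwa [image_rot_hexSide, zero_add] at this
  · have : triRotIsoPow i y₀ ∈ triRotIsoPow i '' hexSide n₃ 0 := ⟨y₀, hy₀, rfl⟩
    rwa [image_rot_hexSide, zero_add] at this
  · rintro w ⟨⟨v, ⟨hvA, hvZ⟩, rfl⟩, hwc⟩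
    refine ⟨⟨?_, ?_⟩, hwc⟩
    · rw [← image_rot_eq_glueZone]
      exact ⟨v, hvZ, rfl⟩
    · rw [mem_triAnnSet, triNorm_rot]
      exact hvA

/-- **The extended arm of colour `b` in frame `i` runs from side `i` of `∂Λ_{n₁}` to side `i` of
`∂Λ_{512Q - 1}`** (as `sepArmAt_glueExt_path_landed`, with the inner landing). [cite: Nolin2008, §4.3 Prop. 12 (proof) (arXiv 0711.4948: Prop. 11)] -/
theorem sepArmAt_glueExt_path_dlanded {q n₁ i : ℕ} (n₃ : ℕ) {b : Bool} (hq : 1 ≤ q) (h4 : 4 ≤ n₁)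
    (h₁ : n₁ ≤ 64 * q) {X : Set (Site 2)} {ω : SiteConfig (Site 2)}
    (hA : ω ∈ sepArmAt i b X n₁ (64 * q)) (hG : readFrame i b ω ∈ fourGlueExt q) :
    ∃ x y : Site 2, x ∈ hexSide n₁ i ∧ y ∈ hexSide (512 * (q + 1) - 1) i ∧
      PathIn triGraph (glueZone q n₁ n₃ i X ∅ ∩ triAnnSet n₁ (512 * (q + 1) - 1) ∩ {v | v ∈ ω ↔ b})
        x y := by
  obtain ⟨z', u, y, hz', hu, hy, P⟩ := sepOpenArmIn_glueExt_path_fence hq h4 h₁ hA hG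
  set R : ℕ := 512 * (q + 1) - 1 with hR
  set Z : Set (Site 2) := (triRotIsoPow i) ⁻¹' X ∩ sepConeSupport n₁ (64 * q) ∪ glueRegion q with hZ
  have hq' : (1 : ℤ) ≤ q := by exact_mod_cast hq
  have hc : ((R : ℕ) : ℤ) = 512 * ((q : ℤ) + 1) - 1 := by
    rw [hR]; push_cast [Nat.cast_sub (by omega : 1 ≤ 512 * (q + 1))]; ring
  have h13 : n₁ ≤ R := by omega
  have e8 : 64 * q / 8 = 8 * q := by omega
  have hcone' : ∀ w ∈ Z, triNorm w < n₁ → (0 < w 0 ∧ w 1 < 0 ∧ 0 < w 0 + w 1) := by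
    rintro w (⟨-, hw⟩ | hw) hn
    · rw [mem_sepConeSupport] at hw
      exact hw.2.2 (Or.inl hn)
    · exact (mem_triCone_of_mem_glueRegion hw).1
  have hun : triNorm u < n₁ := triNorm_lt_of_mem_sepInnerFence hz' hu
  -- one more step outward from `y` inside the open cone, to apply the trimming at radius `R`
  -- (`y` has norm exactly `R`; instead, trim at the last exit of `Λ°_{n₁}` directly)
  have P' : PathIn triGraph (Z ∩ readFrame i b ω) u y := P
  rcases P'.last_exit_or (C := {w : Site 2 | triNorm w < n₁}) hun with hyr |
    ⟨a', b', ha', ha'A, hb', hab', hp⟩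
  · simp only [mem_setOf_eq] at hyr; omega
  · simp only [mem_setOf_eq, not_lt] at ha' hb'
    have hb'1 : triNorm b' ≤ triNorm a' + 1 := triNorm_le_triNorm_add_one_of_adj hab'
    have hb'r : triNorm b' = n₁ := by omega
    have ha'r : triNorm a' + 1 = n₁ := by omega
    have hbSide : b' ∈ hexSide n₁ 0 :=
      mem_hexSide_zero_of_adj_cone_inner hb'r ha'r (hcone' a' ha'A.1 ha') hab'
    -- the sites of the remaining path have norm in `[n₁, R]`
    have hyZ := P'.right_mem.1
    have hle : ∀ w ∈ Z, triNorm w ≤ R := by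
      rintro w (⟨-, hw⟩ | hw)
      · rw [mem_sepConeSupport, e8] at hw; push_cast at hw; rw [hc]; omega
      · have := (mem_triCone_of_mem_glueRegion hw).2.2; rw [hc]; omega
    have hySide : y ∈ hexSide R 0 := by
      rcases hyZ with ⟨-, hs⟩ | hg
      · exfalso
        rw [mem_sepConeSupport, e8] at hs; push_cast at hs; omega
      · obtain ⟨hcg, -, -⟩ := mem_triCone_of_mem_glueRegion hg
        have hy0 : y 0 = R := by rw [hc, ← hy, triNorm_eq_apply_zero hcg.2.1.le hcg.2.2.le]
        exact mem_hexSide_zero.2 ⟨hy0, by rw [hc]; omega, hcg.2.1.le⟩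
    have Q : PathIn triGraph (({w : Site 2 | (n₁ : ℤ) ≤ triNorm w ∧ triNorm w ≤ R} ∩ Z) ∩
        rotConfig i {v : Site 2 | v ∈ ω ↔ b}) b' y := by
      refine hp.mono ?_
      rintro w ⟨⟨hw1, hw2⟩, hw3⟩
      simp only [mem_setOf_eq, not_lt] at hw3
      exact ⟨⟨⟨hw3, hle w hw1⟩, hw1⟩, hw2⟩
    have Q'' := pathIn_of_rotConfig_colour i b Q
    refine ⟨triRotIsoPow i b', triRotIsoPow i y, ?_, ?_, Q''.mono ?_⟩
    · have : triRotIsoPow i b' ∈ triRotIsoPow i '' hexSide n₁ 0 := ⟨b', hbSide, rfl⟩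
      rwa [image_rot_hexSide, zero_add] at this
    · have : triRotIsoPow i y ∈ triRotIsoPow i '' hexSide R 0 := ⟨y, hySide, rfl⟩
      rwa [image_rot_hexSide, zero_add] at this
    · rintro w ⟨⟨v, ⟨hvA, hvZ⟩, rfl⟩, hwc⟩
      refine ⟨⟨?_, ?_⟩, hwc⟩
      · rcases hvZ with h | h
        · exact Or.inl (Or.inl ⟨h.1, v, h.2, rfl⟩)
        · exact Or.inl (Or.inr ⟨v, h, rfl⟩)
      · rw [mem_triAnnSet, triNorm_rot]
        exact hvA

/-! ### The fenced event lies in the arc-landed host and in the tree's landed event -/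

/-- Sides `0, 1` form the arc `0`; sides `3, 4` form the arc `3`. [folklore] -/
theorem hexSide_subset_hexSector {K i a : ℕ} (h : i = a ∨ i = a + 1) : hexSide K i ⊆ hexSector K a := by
  rcases h with rfl | rfl
  · exact subset_union_left
  · exact subset_union_right

/-- **The fenced adjacent event lies in the arc-landed host** (`4 ≤ n ≤ N`): the four fenced arms
run from their sides of `∂Λ_n` to their sides of `∂Λ_N` (`sepArmAt_dlandedArm`), inside the
pairwise disjoint sets `X ∩ ρ^i(S)` (disjoint confining sets within a colour, colours otherwise).
[cite: Nolin2008, §4.2 Def. 7–8 (arXiv 0711.4948: Def. 6–7: Ã̃ ⊆ Ā)] -/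
theorem sepFourAdj_subset_arcFourArm {n N : ℕ} (h4 : 4 ≤ n) (hnN : n ≤ N) :
    sepFourAdj n N ⊆ arcFourArm 0 3 n N := by
  rintro ω ⟨⟨X₀, X₁, hX01, hA₀, hA₁⟩, ⟨X₃, X₄, hX34, hA₃, hA₄⟩⟩
  obtain ⟨x₀, y₀, hx₀, hy₀, P₀⟩ := sepArmAt_dlandedArm h4 hnN hA₀
  obtain ⟨x₁, y₁, hx₁, hy₁, P₁⟩ := sepArmAt_dlandedArm h4 hnN hA₁
  obtain ⟨x₃, y₃, hx₃, hy₃, P₃⟩ := sepArmAt_dlandedArm h4 hnN hA₃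
  obtain ⟨x₄, y₄, hx₄, hy₄, P₄⟩ := sepArmAt_dlandedArm h4 hnN hA₄
  set S := sepConeSupport n N with hS
  set T : Fin 4 → Set (Site 2) :=
    ![(X₀ ∩ triRotIsoPow 0 '' S) ∩ triAnnSet n N ∩ {v | v ∈ ω ↔ true},
      (X₃ ∩ triRotIsoPow 3 '' S) ∩ triAnnSet n N ∩ {v | v ∈ ω ↔ false},
      (X₁ ∩ triRotIsoPow 1 '' S) ∩ triAnnSet n N ∩ {v | v ∈ ω ↔ true},
      (X₄ ∩ triRotIsoPow 4 '' S) ∩ triAnnSet n N ∩ {v | v ∈ ω ↔ false}] with hT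
  have d02 : Disjoint (T 0) (T 2) :=
    Disjoint.mono (inter_subset_left.trans (inter_subset_left.trans inter_subset_left))
      (inter_subset_left.trans (inter_subset_left.trans inter_subset_left)) hX01
  have d13 : Disjoint (T 1) (T 3) :=
    Disjoint.mono (inter_subset_left.trans (inter_subset_left.trans inter_subset_left))
      (inter_subset_left.trans (inter_subset_left.trans inter_subset_left)) hX34
  have e : ∀ {A : Set (Site 2)} {b : Bool}, A ∩ triAnnSet n N ∩ {v | v ∈ ω ↔ b} =
      (A ∩ triAnnSet n N) ∩ {v | v ∈ ω ↔ b} := fun {A b} => rfl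
  refine mem_arcFourArm_of_pathIn T ?_ ?_ ?_ ?_
  · intro i j hij
    fin_cases i <;> fin_cases j
    all_goals first
      | exact absurd rfl hij
      | exact d02 | exact d02.symm | exact d13 | exact d13.symm
      | exact disjoint_inter_colour (by decide)
  · intro i z hz
    fin_cases i <;> simpa [hT] using hz.2
  · intro i z hz
    fin_cases i <;> exact (mem_triAnnSet.1 (by simpa [hT] using hz.1.2))
  · intro i
    fin_cases i
    · exact ⟨x₀, hexSide_subset_hexSector (Or.inl rfl) hx₀, y₀,
        hexSide_subset_hexSector (Or.inl rfl) hy₀, P₀⟩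
    · exact ⟨x₃, hexSide_subset_hexSector (Or.inl rfl) hx₃, y₃,
        hexSide_subset_hexSector (Or.inl rfl) hy₃, P₃⟩
    · exact ⟨x₁, hexSide_subset_hexSector (Or.inr rfl) hx₁, y₁,
        hexSide_subset_hexSector (Or.inr rfl) hy₁, P₁⟩
    · exact ⟨x₄, hexSide_subset_hexSector (Or.inr rfl) hx₄, y₄,
        hexSide_subset_hexSector (Or.inr rfl) hy₄, P₄⟩

/-- **The host with arcs `0, 3` lies in the tree's `landedFourAdj`** when its arms land on the
prescribed sides: a family of `arcFourArm`-arms whose outer extremities lie on the sides `0`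
(arm `0`), `1` (arm `2`), `3` (arm `1`), `4` (arm `3`) satisfies the coordinate conditions of
`landedFourAdj`. Here for the fenced event, whose arms do land on these sides. [cite: Nolin2008, §4.2 Def. 7–8 (arXiv 0711.4948: Def. 6–7: Ã̃ ⊆ Ā)] -/
theorem sepFourAdj_subset_landedFourAdj {n N : ℕ} (h4 : 4 ≤ n) (hnN : n ≤ N) :
    sepFourAdj n N ⊆ landedFourAdj n N := by
  classical
  rintro ω ⟨⟨X₀, X₁, hX01, hA₀, hA₁⟩, ⟨X₃, X₄, hX34, hA₃, hA₄⟩⟩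
  obtain ⟨x₀, y₀, hx₀, hy₀, P₀⟩ := sepArmAt_dlandedArm h4 hnN hA₀
  obtain ⟨x₁, y₁, hx₁, hy₁, P₁⟩ := sepArmAt_dlandedArm h4 hnN hA₁
  obtain ⟨x₃, y₃, hx₃, hy₃, P₃⟩ := sepArmAt_dlandedArm h4 hnN hA₃
  obtain ⟨x₄, y₄, hx₄, hy₄, P₄⟩ := sepArmAt_dlandedArm h4 hnN hA₄
  set S := sepConeSupport n N with hS
  -- the four site sets, and self-avoiding walks inside them
  set Tset : Fin 4 → Set (Site 2) :=
    ![(X₀ ∩ triRotIsoPow 0 '' S) ∩ triAnnSet n N ∩ {v | v ∈ ω ↔ true},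
      (X₃ ∩ triRotIsoPow 3 '' S) ∩ triAnnSet n N ∩ {v | v ∈ ω ↔ false},
      (X₁ ∩ triRotIsoPow 1 '' S) ∩ triAnnSet n N ∩ {v | v ∈ ω ↔ true},
      (X₄ ∩ triRotIsoPow 4 '' S) ∩ triAnnSet n N ∩ {v | v ∈ ω ↔ false}] with hTset
  set xs : Fin 4 → Site 2 := ![x₀, x₃, x₁, x₄] with hxs
  set ys : Fin 4 → Site 2 := ![y₀, y₃, y₁, y₄] with hys
  have hp : ∀ j : Fin 4, PathIn triGraph (Tset j) (xs j) (ys j) := by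
    intro j; fin_cases j
    · exact P₀
    · exact P₃
    · exact P₁
    · exact P₄
  have hW : ∀ j, ∃ W : triGraph.Walk (xs j) (ys j), ∀ z ∈ W.support, z ∈ Tset j :=
    fun j => (hp j).exists_walk
  choose W hWs using hW
  have d02 : Disjoint (Tset 0) (Tset 2) :=
    Disjoint.mono (inter_subset_left.trans (inter_subset_left.trans inter_subset_left))
      (inter_subset_left.trans (inter_subset_left.trans inter_subset_left)) hX01
  have d13 : Disjoint (Tset 1) (Tset 3) :=
    Disjoint.mono (inter_subset_left.trans (inter_subset_left.trans inter_subset_left))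
      (inter_subset_left.trans (inter_subset_left.trans inter_subset_left)) hX34
  have hdT : Pairwise fun i j => Disjoint (Tset i) (Tset j) := by
    intro i j hij
    fin_cases i <;> fin_cases j
    all_goals first
      | exact absurd rfl hij
      | exact d02 | exact d02.symm | exact d13 | exact d13.symm
      | exact disjoint_inter_colour (by decide)
  have hcolT : ∀ i, ∀ z ∈ Tset i, (z ∈ ω ↔ (![true, false, true, false] : Fin 4 → Bool) i = true) := by
    intro i z hz
    fin_cases i <;> simpa [hTset] using hz.2
  have hannT : ∀ i, ∀ z ∈ Tset i, (n : ℤ) ≤ triNorm z ∧ triNorm z ≤ N := by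
    intro i z hz
    fin_cases i <;> exact (mem_triAnnSet.1 (by simpa [hTset] using hz.1.2))
  refine ⟨xs, ys, fun j => ((W j).toPath : triGraph.Walk (xs j) (ys j)), fun j => ?_, ?_, ?_⟩
  · have hsub : ∀ z ∈ ((W j).toPath : triGraph.Walk (xs j) (ys j)).support, z ∈ Tset j :=
      fun z hz => hWs j z (SimpleGraph.Walk.support_toPath_subset_support (W j) hz)
    have hxn : triNorm (xs j) = n := by
      fin_cases j
      · exact triNorm_of_mem_hexSide hx₀
      · exact triNorm_of_mem_hexSide hx₃
      · exact triNorm_of_mem_hexSide hx₁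
      · exact triNorm_of_mem_hexSide hx₄
    have hyn : triNorm (ys j) = N := by
      fin_cases j
      · exact triNorm_of_mem_hexSide hy₀
      · exact triNorm_of_mem_hexSide hy₃
      · exact triNorm_of_mem_hexSide hy₁
      · exact triNorm_of_mem_hexSide hy₄
    refine ⟨mem_triSphere_iff.2 hxn, mem_triSphere_iff.2 hyn, (W j).toPath.2, fun z hz => ?_,
      fun z hz => ?_⟩
    · obtain ⟨h1, h2⟩ := hannT j z (hsub z hz)
      rcases eq_or_lt_of_le h1 with h1 | h1
      · right; rw [mem_triSphere_iff, ← h1]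
      · left
        simp only [mem_sdiff, Finset.mem_coe, mem_triBall_iff, not_le]
        exact ⟨h2, h1⟩
    · have := hcolT j z (hsub z hz)
      simpa using this
  · intro i j hij
    rw [Finset.disjoint_left]
    intro z hzi hzj
    have hi := hWs i z (SimpleGraph.Walk.support_toPath_subset_support (W i) (List.mem_toFinset.1 hzi))
    have hj := hWs j z (SimpleGraph.Walk.support_toPath_subset_support (W j) (List.mem_toFinset.1 hzj))
    exact Set.disjoint_left.1 (hdT hij) hi hj
  · refine ⟨?_, ?_, ?_, ?_⟩
    · show y₀ 0 = N
      exact (mem_hexSide_zero.1 hy₀).1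
    · show y₁ 0 + y₁ 1 = N
      exact (coord_of_mem_hexSide_one hy₁).1
    · show y₃ 0 = -(N : ℤ)
      exact (coord_of_mem_hexSide_three hy₃).1
    · show y₄ 0 + y₄ 1 = -(N : ℤ)
      exact (coord_of_mem_hexSide_four hy₄).1

/-- **The landing hypothesis of the four-arm bridge from adjacent separation.** If, at a density
`t` and scales `4 ≤ n ≤ N`, `c · P_t(adjFourArmCyc n N) ≤ P_t(sepFourAdj n N)` (Nolin's Thm. 11 for
`σ = BBWW`, with the cyclic-order event on the left), then
`c · P_t(adjFourArm n N) ≤ P_t(landedFourAdj n N)` — the hypothesis `hLand` of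
`fourArm_bridge_of_landing_of_flip` at `t = 1/2` (`adjFourArm ⊆ adjFourArmCyc`,
`sepFourAdj ⊆ landedFourAdj`). [cite: Nolin2008, §4.3 Thm. 11 and §5.1 Prop. 20 (arXiv 0711.4948: Thm. 10, Prop. 19)] -/
theorem adjFourArm_landing_of_adjSeparation (t : unitInterval) {c : ℝ} (hc : 0 ≤ c) {n N : ℕ}
    (h4 : 4 ≤ n) (hnN : n ≤ N)
    (hsep : c * (triSitePercolation t).real (adjFourArmCyc n N) ≤
      (triSitePercolation t).real (sepFourAdj n N)) :
    c * (triSitePercolation t).real (adjFourArm n N) ≤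
      (triSitePercolation t).real (landedFourAdj n N) :=
  calc c * (triSitePercolation t).real (adjFourArm n N)
      ≤ c * (triSitePercolation t).real (adjFourArmCyc n N) :=
        mul_le_mul_of_nonneg_left (measureReal_mono (adjFourArm_subset_adjFourArmCyc (by omega) hnN)
          (measure_ne_top _ _)) hc
    _ ≤ (triSitePercolation t).real (sepFourAdj n N) := hsep
    _ ≤ (triSitePercolation t).real (landedFourAdj n N) :=
        measureReal_mono (sepFourAdj_subset_landedFourAdj h4 hnN) (measure_ne_top _ _)

/-- **`hLand` from Nolin's Thm. 11 for `BBWW` at `p = 1/2`**, in the `∃ c n₀` shape of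
`fourArm_bridge_of_landing_of_flip`. [cite: Nolin2008, §4.3 Thm. 11 (arXiv 0711.4948: Thm. 10), σ = BBWW] -/
theorem fourArm_hLand_of_adjCycSeparation
    (hsep : ∃ c : ℝ, 0 < c ∧ ∃ n₀ : ℕ, ∀ n N : ℕ, n₀ ≤ n → 2 * n ≤ N →
      c * (triSitePercolation half).real (adjFourArmCyc n N) ≤
        (triSitePercolation half).real (sepFourAdj n N)) :
    ∃ c : ℝ, 0 < c ∧ ∃ n₀ : ℕ, ∀ n N : ℕ, n₀ ≤ n → 2 * n ≤ N →
      c * (triSitePercolation half).real (adjFourArm n N) ≤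
        (triSitePercolation half).real (landedFourAdj n N) := by
  obtain ⟨c, hc, n₀, h⟩ := hsep
  refine ⟨c, hc, max n₀ 4, fun n N hn hnN => ?_⟩
  exact adjFourArm_landing_of_adjSeparation half hc.le (le_trans (le_max_right _ _) hn) (by omega)
    (h n N (le_trans (le_max_left _ _) hn) hnN)

/-! ### Gluing and extension land in the host -/

/-- **The four rotated gluing events for the adjacent arrangement**: open gluing in the frames of
the sides `0, 1`, closed gluing in the frames of the sides `3, 4`. [cite: Nolin2008, §4.3 Prop. 12 (proof) (arXiv 0711.4948: Prop. 11)] -/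
def fourGlueFramesAdj (q : ℕ) : Set (SiteConfig (Site 2)) :=
  (readFrame 0 true ⁻¹' fourGlue q ∩ readFrame 1 true ⁻¹' fourGlue q) ∩
    (readFrame 3 false ⁻¹' fourGlue q ∩ readFrame 4 false ⁻¹' fourGlue q)

/-- **The four rotated extension events for the adjacent arrangement.** [cite: Nolin2008, §4.3 Prop. 12 (proof) (arXiv 0711.4948: Prop. 11)] -/
def fourGlueExtFramesAdj (q : ℕ) : Set (SiteConfig (Site 2)) :=
  (readFrame 0 true ⁻¹' fourGlueExt q ∩ readFrame 1 true ⁻¹' fourGlueExt q) ∩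
    (readFrame 3 false ⁻¹' fourGlueExt q ∩ readFrame 4 false ⁻¹' fourGlueExt q)

/-- **Gluing four well-separated adjacent arms lands in the arc-landed host** (Nolin 2008, proof
of Prop. 12 (ii) [arXiv 0711.4948: Prop. 11], `j = 4`, `σ = BBWW`): fenced adjacent events across
`Λ_{64q} ∖ Λ_{n₁}` and across `Λ_{n₃} ∖ Λ_{512(q+1)}` together with the four rotated gluing events
are contained in `arcFourArm 0 3 n₁ n₃` — each glued arm runs from its side of `∂Λ_{n₁}` to its
side of `∂Λ_{n₃}` (`sepArmAt_glue_path_dlanded`), in pairwise disjoint zones (`glueZone_disjoint`).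
[cite: Nolin2008, §4.3 Prop. 12 (arXiv 0711.4948: Prop. 11)] [cite: KestenScalingCMP1987, Lemmas 4–6] -/
theorem sepFourAdj_glue_subset_arcFourArm {q n₁ n₃ : ℕ} (hq : 1 ≤ q) (h4 : 4 ≤ n₁) (h₁ : n₁ ≤ 64 * q)
    (h₃ : 512 * (q + 1) ≤ n₃) :
    sepFourAdj n₁ (64 * q) ∩ fourGlueFramesAdj q ∩ sepFourAdj (512 * (q + 1)) n₃ ⊆
      arcFourArm 0 3 n₁ n₃ := by
  rintro ω ⟨⟨⟨⟨X₀, X₁, hX01, hA₀, hA₁⟩, ⟨X₃, X₄, hX34, hA₃, hA₄⟩⟩, ⟨hG₀, hG₁⟩, hG₃, hG₄⟩,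
    ⟨Y₀, Y₁, hY01, hB₀, hB₁⟩, ⟨Y₃, Y₄, hY34, hB₃, hB₄⟩⟩
  have P₀ := sepArmAt_glue_path_dlanded hq h4 h₁ h₃ hA₀ hG₀ hB₀
  have P₁ := sepArmAt_glue_path_dlanded hq h4 h₁ h₃ hA₁ hG₁ hB₁
  have P₃ := sepArmAt_glue_path_dlanded hq h4 h₁ h₃ hA₃ hG₃ hB₃
  have P₄ := sepArmAt_glue_path_dlanded hq h4 h₁ h₃ hA₄ hG₄ hB₄
  set T : Fin 4 → Set (Site 2) :=
    ![glueZone q n₁ n₃ 0 X₀ Y₀ ∩ triAnnSet n₁ n₃ ∩ {v | v ∈ ω ↔ true},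
      glueZone q n₁ n₃ 3 X₃ Y₃ ∩ triAnnSet n₁ n₃ ∩ {v | v ∈ ω ↔ false},
      glueZone q n₁ n₃ 1 X₁ Y₁ ∩ triAnnSet n₁ n₃ ∩ {v | v ∈ ω ↔ true},
      glueZone q n₁ n₃ 4 X₄ Y₄ ∩ triAnnSet n₁ n₃ ∩ {v | v ∈ ω ↔ false}] with hT
  have d02 : Disjoint (T 0) (T 2) :=
    Disjoint.mono (inter_subset_left.trans inter_subset_left) (inter_subset_left.trans inter_subset_left)
      (glueZone_disjoint hq (by norm_num) (by norm_num) (by norm_num) hX01 hY01)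
  have d13 : Disjoint (T 1) (T 3) :=
    Disjoint.mono (inter_subset_left.trans inter_subset_left) (inter_subset_left.trans inter_subset_left)
      (glueZone_disjoint hq (by norm_num) (by norm_num) (by norm_num) hX34 hY34)
  refine mem_arcFourArm_of_pathIn T ?_ ?_ ?_ ?_
  · intro i j hij
    fin_cases i <;> fin_cases j
    all_goals first
      | exact absurd rfl hij
      | exact d02 | exact d02.symm | exact d13 | exact d13.symm
      | exact disjoint_inter_colour (by decide)
  · intro i z hz
    fin_cases i <;> simpa [hT] using hz.2
  · intro i z hz
    fin_cases i <;> exact (mem_triAnnSet.1 (by simpa [hT] using hz.1.2))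
  · intro i
    fin_cases i
    · obtain ⟨x, y, hx, hy, Q⟩ := P₀
      exact ⟨x, hexSide_subset_hexSector (Or.inl rfl) hx, y, hexSide_subset_hexSector (Or.inl rfl) hy, Q⟩
    · obtain ⟨x, y, hx, hy, Q⟩ := P₃
      exact ⟨x, hexSide_subset_hexSector (Or.inl rfl) hx, y, hexSide_subset_hexSector (Or.inl rfl) hy, Q⟩
    · obtain ⟨x, y, hx, hy, Q⟩ := P₁
      exact ⟨x, hexSide_subset_hexSector (Or.inr rfl) hx, y, hexSide_subset_hexSector (Or.inr rfl) hy, Q⟩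
    · obtain ⟨x, y, hx, hy, Q⟩ := P₄
      exact ⟨x, hexSide_subset_hexSector (Or.inr rfl) hx, y, hexSide_subset_hexSector (Or.inr rfl) hy, Q⟩

/-- **Extending four well-separated adjacent arms lands in the arc-landed host**:
`sepFourAdj n₁ (64q) ∩ fourGlueExtFramesAdj q ⊆ arcFourArm 0 3 n₁ (512(q+1) - 1)`. [cite: Nolin2008, §4.3 Prop. 12 (i) (arXiv 0711.4948: Prop. 11)] [cite: KestenScalingCMP1987, Lemma 4] -/
theorem sepFourAdj_glueExt_subset_arcFourArm {q n₁ : ℕ} (hq : 1 ≤ q) (h4 : 4 ≤ n₁) (h₁ : n₁ ≤ 64 * q) :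
    sepFourAdj n₁ (64 * q) ∩ fourGlueExtFramesAdj q ⊆ arcFourArm 0 3 n₁ (512 * (q + 1) - 1) := by
  rintro ω ⟨⟨⟨X₀, X₁, hX01, hA₀, hA₁⟩, ⟨X₃, X₄, hX34, hA₃, hA₄⟩⟩, ⟨hG₀, hG₁⟩, hG₃, hG₄⟩
  set n₃ : ℕ := 512 * (q + 1) - 1 with hn₃
  have P₀ := sepArmAt_glueExt_path_dlanded n₃ hq h4 h₁ hA₀ hG₀
  have P₁ := sepArmAt_glueExt_path_dlanded n₃ hq h4 h₁ hA₁ hG₁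
  have P₃ := sepArmAt_glueExt_path_dlanded n₃ hq h4 h₁ hA₃ hG₃
  have P₄ := sepArmAt_glueExt_path_dlanded n₃ hq h4 h₁ hA₄ hG₄
  set T : Fin 4 → Set (Site 2) :=
    ![glueZone q n₁ n₃ 0 X₀ ∅ ∩ triAnnSet n₁ n₃ ∩ {v | v ∈ ω ↔ true},
      glueZone q n₁ n₃ 3 X₃ ∅ ∩ triAnnSet n₁ n₃ ∩ {v | v ∈ ω ↔ false},
      glueZone q n₁ n₃ 1 X₁ ∅ ∩ triAnnSet n₁ n₃ ∩ {v | v ∈ ω ↔ true},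
      glueZone q n₁ n₃ 4 X₄ ∅ ∩ triAnnSet n₁ n₃ ∩ {v | v ∈ ω ↔ false}] with hT
  have hE : Disjoint (∅ : Set (Site 2)) ∅ := disjoint_bot_left
  have d02 : Disjoint (T 0) (T 2) :=
    Disjoint.mono (inter_subset_left.trans inter_subset_left) (inter_subset_left.trans inter_subset_left)
      (glueZone_disjoint hq (by norm_num) (by norm_num) (by norm_num) hX01 hE)
  have d13 : Disjoint (T 1) (T 3) :=
    Disjoint.mono (inter_subset_left.trans inter_subset_left) (inter_subset_left.trans inter_subset_left)
      (glueZone_disjoint hq (by norm_num) (by norm_num) (by norm_num) hX34 hE)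
  refine mem_arcFourArm_of_pathIn T ?_ ?_ ?_ ?_
  · intro i j hij
    fin_cases i <;> fin_cases j
    all_goals first
      | exact absurd rfl hij
      | exact d02 | exact d02.symm | exact d13 | exact d13.symm
      | exact disjoint_inter_colour (by decide)
  · intro i z hz
    fin_cases i <;> simpa [hT] using hz.2
  · intro i z hz
    fin_cases i <;> exact (mem_triAnnSet.1 (by simpa [hT] using hz.1.2))
  · intro i
    fin_cases i
    · obtain ⟨x, y, hx, hy, Q⟩ := P₀
      exact ⟨x, hexSide_subset_hexSector (Or.inl rfl) hx, y, hexSide_subset_hexSector (Or.inl rfl) hy, Q⟩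
    · obtain ⟨x, y, hx, hy, Q⟩ := P₃
      exact ⟨x, hexSide_subset_hexSector (Or.inl rfl) hx, y, hexSide_subset_hexSector (Or.inl rfl) hy, Q⟩
    · obtain ⟨x, y, hx, hy, Q⟩ := P₁
      exact ⟨x, hexSide_subset_hexSector (Or.inr rfl) hx, y, hexSide_subset_hexSector (Or.inr rfl) hy, Q⟩
    · obtain ⟨x, y, hx, hy, Q⟩ := P₄
      exact ⟨x, hexSide_subset_hexSector (Or.inr rfl) hx, y, hexSide_subset_hexSector (Or.inr rfl) hy, Q⟩

end Literature.Probability.Percolation
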